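import Mathlib
import Literature.Combinatorics.Optimization.LpFormulationReductions
import Literature.Barriers.PneNP.TSPExtensionComplexityKaibelWeltge
import HarnessLib

/-!
# LP formulation complexity of maximizing `k`-juntas (Braun–Pokutta–Zink 2015, Example 3.11)

G. Braun, S. Pokutta, D. Zink, *Inapproximability of combinatorial problems via small LPs and SDPs*, STOC 2015
[BraunPokuttaZink2015] (held `paper:arxiv-1410.8816`, §3.1.3 "`k`-juntas via LPs", p. 12), **Example 3.11**: "the
level-`k` Sherali–Adams hierarchy captures all nonnegative `k`-juntas … using `O(n^k)` inequalities. We will now show that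
this is essentially optimal for `k` small. … Let the set of instances `𝓕` be the family of all nonnegative `k`-juntas and …
`𝒮 = {0,1}ⁿ`, `val_f(s) = f(s)`, `C(f) = S(f) = max_s val_f(s)`. … `𝓕' := {f_a : a ∈ {0,1}ⁿ, |a| = k}` with
`f_a(b) := aᵀb − 2·C(aᵀb, 2)`, hence `C(f_a) = 1` … `S_{a,b} = C(f_a) − f_a(b) = (1 − aᵀb)²` … `= 1` if `a ∩ b = ∅` and there
are `2^{n−k}` such choices for `b` for a given `a` … in [Kaibel–Weltge] it was shown that any nonnegative rank-1 matrix can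
cover at most `2ⁿ` of such pairs. Thus the nonnegative rank of `S` is at least `C(n,k)2^{n−k}/2ⁿ = C(n,k)/2^k`" — `Ω(n^k)` for
constant `k`.

PROVED here (no named facts): `juntaProblem n k` (the printed problem), the hard rows `gJunta a` (`|a| ≤ k`) with
`slack_gJunta : S(g_a, 𝟙_b) = 1 − [|a ∩ b| = 1]`, the count `card_disjPairs_fst_card` (`C(n,k)·2^{n−k}` disjoint pairs with
`|a| = k`), the lower bound `choose_le_of_hasNonnegFactorization_junta` (`nnr ≥ C(n,k)/2^k`, by the Kaibel–Weltge covering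
bound — the TREE THEOREM `Literature.Barriers.PneNP.IsKWValid.card_le_two_pow` [KaibelWeltge2014, Thm. 1]: the disjoint pairs
in the support rectangle of one nonnegative rank-one term form a valid set because the term vanishes where the slack does,
at `|a ∩ b| = 1`), and `junta_lpFormulation_lower` (no LP formulation of size `R` with `(R+1)·2^k < C(n,k)`, via the LP
factorization theorem of `LpFormulationReductions.lean`).

RECORDED REPAIR (statement-level, affecting only the choice of hard instances): the printed `f_a(b) = aᵀb − 2·C(aᵀb,2) =
1 − (1 − aᵀb)²` is NEGATIVE for `aᵀb ≥ 3`, so for `k ≥ 3` it is not a member of the printed instance family of NONNEGATIVE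
juntas.  We use instead its positive part `g_a(b) = [aᵀb = 1]` (a nonnegative `k`-junta with `max g_a = 1`), whose slack
`1 − [aᵀb = 1]` has exactly the two features the covering argument uses — value `1` at disjoint pairs and `0` at
`|a ∩ b| = 1` — so the printed conclusion `nnr(S) ≥ C(n,k)/2^k` holds for the printed problem as stated.  Not here: the
upper bounds (`nnr ≤ C(n,k)` on `𝓕'`, and the `O(n^k)` Sherali–Adams LP).
-/

noncomputable section

open Finset
open scoped Classical

namespace Literature.Combinatorics.Optimization

open Literature.Barriers.PneNP (disjPairs mem_disjPairs IsKWValid disjPairs_filter_fst_eq)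

variable {n k : ℕ}

/-! ### The problem: maximizing nonnegative `k`-juntas over the cube -/

/-- A **nonnegative `k`-junta** on `{0,1}ⁿ`: `f ≥ 0` depending only on (at most) `k` coordinates.
[cite: BraunPokuttaZink2015, Ex. 3.11 (§3.1.3)] -/
def Junta (n k : ℕ) : Type :=
  {f : (Fin n → Bool) → ℝ // (∀ x, 0 ≤ f x) ∧
    ∃ J : Finset (Fin n), J.card ≤ k ∧ ∀ x y : Fin n → Bool, (∀ i ∈ J, x i = y i) → f x = f y}

/-- **Example 3.11 (`k`-juntas)**: "the problem of maximizing nonnegative `k`-juntas over the `n`-dimensional hypercube.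
Let the set of instances `𝓕` be the family of all nonnegative `k`-juntas and let the set of feasible solutions be
`𝒮 = {0,1}ⁿ` with `val_f(s) = f(s)`. We put `C(f) = S(f) = max_{s ∈ 𝒮} val_f(s)`."
[cite: BraunPokuttaZink2015, Ex. 3.11 (§3.1.3)] -/
def juntaProblem (n k : ℕ) : MaxProblem (Fin n → Bool) (Junta n k) where
  val f x := f.1 x
  C f := sSup (Set.range f.1)
  S f := sSup (Set.range f.1)

/-- Every instance is sound (`S(f) = max f`). [cite: BraunPokuttaZink2015, Ex. 3.11] -/
theorem juntaProblem_sound (f : Junta n k) : (juntaProblem n k).Sound f :=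
  fun x => le_csSup (Set.finite_range f.1).bddAbove ⟨x, rfl⟩

/-! ### The hard sub-family `g_a = [|a ∩ b| = 1]`, `|a| = k` -/

/-- The support of a Boolean vector. [folklore] -/
def bsupp (x : Fin n → Bool) : Finset (Fin n) := univ.filter fun i => x i = true

/-- The indicator vector of a set of coordinates. [folklore] -/
def bind (b : Finset (Fin n)) : Fin n → Bool := fun i => decide (i ∈ b)

/-- `supp(𝟙_b) = b`. [folklore] -/
@[simp] private theorem bsupp_bind (b : Finset (Fin n)) : bsupp (bind b) = b := by
  ext i; simp [bsupp, bind]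

/-- The junta `g_a(x) = [|a ∩ supp x| = 1]` — the positive part of the printed
`f_a(b) = aᵀb − 2·C(aᵀb, 2) = 1 − (1 − aᵀb)²` (which is negative for `aᵀb ≥ 3`; the covering argument below uses only
the values at `aᵀb ∈ {0, 1}`, where the two agree). [cite: BraunPokuttaZink2015, Ex. 3.11] -/
def gFun (a : Finset (Fin n)) : (Fin n → Bool) → ℝ := fun x => if (a ∩ bsupp x).card = 1 then 1 else 0

/-- `g_a` is a nonnegative `k`-junta for `|a| ≤ k` (it depends on the coordinates in `a` only).
[cite: BraunPokuttaZink2015, Ex. 3.11] -/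
def gJunta (a : Finset (Fin n)) (ha : a.card ≤ k) : Junta n k :=
  ⟨gFun a, fun x => by unfold gFun; split_ifs <;> norm_num, a, ha, fun x y hxy => by
    have : a ∩ bsupp x = a ∩ bsupp y := by
      ext i
      simp only [mem_inter, bsupp, mem_filter, mem_univ, true_and]
      constructor
      · rintro ⟨hi, hx⟩; exact ⟨hi, (hxy i hi) ▸ hx⟩
      · rintro ⟨hi, hy⟩; exact ⟨hi, (hxy i hi).symm ▸ hy⟩
    simp only [gFun, this]⟩

/-- `max g_a = 1` for `a ≠ ∅` ("hence `C(f_a) = 1`"). [cite: BraunPokuttaZink2015, Ex. 3.11] -/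
theorem sSup_gFun (a : Finset (Fin n)) (ha : a.Nonempty) : sSup (Set.range (gFun a)) = 1 := by
  obtain ⟨i₀, hi₀⟩ := ha
  refine IsGreatest.csSup_eq ⟨⟨bind {i₀}, ?_⟩, ?_⟩
  · have : a ∩ bsupp (bind ({i₀} : Finset (Fin n))) = {i₀} := by
      rw [bsupp_bind]; exact inter_singleton_of_mem hi₀
    show (if (a ∩ bsupp (bind ({i₀} : Finset (Fin n)))).card = 1 then (1 : ℝ) else 0) = 1
    rw [this, card_singleton, if_pos rfl]
  · rintro _ ⟨x, rfl⟩
    unfold gFun; split_ifs <;> norm_num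

/-- **The slack matrix on the sub-family**: `S(g_a, 𝟙_b) = C(g_a) − g_a(b) = 1 − [|a ∩ b| = 1]` (printed:
`(1 − aᵀb)²`, which has the same zero pattern at `aᵀb = 1` and the same value `1` at disjoint pairs).
[cite: BraunPokuttaZink2015, Ex. 3.11] -/
theorem slack_gJunta (a : Finset (Fin n)) (ha : a.card ≤ k) (ha0 : a.Nonempty) (b : Finset (Fin n)) :
    (juntaProblem n k).slackMatrix ⟨gJunta a ha, juntaProblem_sound _⟩ (bind b) =
      if (a ∩ b).card = 1 then 0 else 1 := by
  simp only [MaxProblem.slackMatrix_apply, juntaProblem, gJunta, sSup_gFun a ha0, gFun, bsupp_bind]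
  split_ifs <;> norm_num

/-! ### The covering bound (Kaibel–Weltge) and the lower bound `nnr ≥ C(n,k)/2^k` -/

/-- The disjoint pairs `(a, b)` with `|a| = k`: there are `C(n,k)·2^{n−k}` of them ("there are `2^{n−k}` such choices for
`b` for a given `a`"). [cite: BraunPokuttaZink2015, Ex. 3.11] -/
theorem card_disjPairs_fst_card (n k : ℕ) :
    ((disjPairs (univ : Finset (Fin n))).filter fun p => p.1.card = k).card = n.choose k * 2 ^ (n - k) := by
  rw [card_eq_sum_card_fiberwise (f := Prod.fst) (t := powersetCard k (univ : Finset (Fin n)))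
    (fun p hp => by
      simp only [coe_filter, Set.mem_setOf_eq] at hp
      exact mem_coe.2 (mem_powersetCard.2 ⟨subset_univ _, hp.2⟩))]
  have hfib : ∀ a ∈ powersetCard k (univ : Finset (Fin n)),
      (((disjPairs (univ : Finset (Fin n))).filter fun p => p.1.card = k).filter fun p => p.1 = a).card =
        2 ^ (n - k) := by
    intro a ha
    rw [mem_powersetCard] at ha
    have : (((disjPairs (univ : Finset (Fin n))).filter fun p => p.1.card = k).filter fun p => p.1 = a) =
        (disjPairs (univ : Finset (Fin n))).filter fun p => p.1 = a := by
      ext p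
      simp only [mem_filter]
      constructor
      · rintro ⟨⟨h1, -⟩, h3⟩; exact ⟨h1, h3⟩
      · rintro ⟨h1, h3⟩; exact ⟨⟨h1, h3 ▸ ha.2⟩, h3⟩
    rw [this, disjPairs_filter_fst_eq (subset_univ a), card_image_of_injective _ fun b b' h => (Prod.ext_iff.1 h).2,
      card_powerset, card_sdiff_of_subset (subset_univ a), card_univ, Fintype.card_fin, ha.2]
  rw [sum_congr rfl hfib, sum_const, card_powersetCard, card_univ, Fintype.card_fin, smul_eq_mul]

/-- **Example 3.11, the lower bound** ("any nonnegative rank-1 matrix can cover at most `2ⁿ` of such pairs [Kaibel–Weltge].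
Thus the nonnegative rank of `S` is at least `C(n,k)2^{n−k}/2ⁿ = C(n,k)/2^k`"): a nonnegative factorization of the slack
matrix of the `k`-junta problem of size `r` forces `C(n,k) ≤ r·2^k` (`1 ≤ k ≤ n`).  Proof as printed: each rank-one term
vanishes where the slack vanishes (`|a ∩ b| = 1`), so the disjoint pairs in its support form a Kaibel–Weltge valid set
(`≤ 2ⁿ` pairs, the tree's `IsKWValid.card_le_two_pow`), and the `C(n,k)·2^{n−k}` disjoint pairs (slack `1`) are covered.
[cite: BraunPokuttaZink2015, Ex. 3.11] [cite: KaibelWeltge2014, Thm. 1] -/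
theorem choose_le_of_hasNonnegFactorization_junta (hk : 1 ≤ k) (hkn : k ≤ n) {r : ℕ}
    (h : HasNonnegFactorization (juntaProblem n k).slackMatrix r) : n.choose k ≤ r * 2 ^ k := by
  -- restrict to the rows `g_a`, `|a| = k`, and the columns `𝟙_b`
  have hne : ∀ a : {a : Finset (Fin n) // a.card = k}, a.1.Nonempty := fun a =>
    card_pos.1 (by rw [a.2]; exact hk)
  obtain ⟨U, V, hU, hV, hM⟩ := h.submatrix
    (fun a : {a : Finset (Fin n) // a.card = k} => ⟨gJunta a.1 (le_of_eq a.2), juntaProblem_sound _⟩)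
    (fun b : Finset (Fin n) => bind b)
  have hS : ∀ (a : {a : Finset (Fin n) // a.card = k}) (b : Finset (Fin n)),
      (if (a.1 ∩ b).card = 1 then (0 : ℝ) else 1) = ∑ l, U a l * V l b := fun a b => by
    rw [← slack_gJunta a.1 (le_of_eq a.2) (hne a) b]; exact hM a b
  -- the disjoint pairs with `|a| = k`, and the support rectangles of the rank-one terms
  set D := (disjPairs (univ : Finset (Fin n))).filter fun p => p.1.card = k with hD
  let Rl : Fin r → Finset (Finset (Fin n) × Finset (Fin n)) := fun l =>
    D.filter fun p => ∃ h : p.1.card = k, 0 < U ⟨p.1, h⟩ l ∧ 0 < V l p.2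
  -- every disjoint pair is covered
  have hcover : D ⊆ univ.biUnion Rl := by
    intro p hp
    have hp' := mem_filter.1 hp
    have hpk : p.1.card = k := hp'.2
    have hdisj : Disjoint p.1 p.2 := (mem_disjPairs.1 hp'.1).2.2
    have h1 : (1 : ℝ) = ∑ l, U ⟨p.1, hpk⟩ l * V l p.2 := by
      have := hS ⟨p.1, hpk⟩ p.2
      rwa [if_neg (by rw [disjoint_iff_inter_eq_empty.1 hdisj, card_empty]; omega)] at this
    obtain ⟨l, -, hl⟩ : ∃ l ∈ (univ : Finset (Fin r)), 0 < U ⟨p.1, hpk⟩ l * V l p.2 := by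
      by_contra hcon
      have hcon' : ∀ l ∈ (univ : Finset (Fin r)), U ⟨p.1, hpk⟩ l * V l p.2 ≤ 0 :=
        fun l hl => not_lt.1 fun h' => hcon ⟨l, hl, h'⟩
      have : ∑ l, U ⟨p.1, hpk⟩ l * V l p.2 ≤ 0 := sum_nonpos hcon'
      linarith
    have hUl : 0 < U ⟨p.1, hpk⟩ l := lt_of_le_of_ne (hU _ _) fun h0 => by rw [← h0, zero_mul] at hl; exact lt_irrefl _ hl
    have hVl : 0 < V l p.2 := lt_of_le_of_ne (hV _ _) fun h0 => by rw [← h0, mul_zero] at hl; exact lt_irrefl _ hl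
    exact mem_biUnion.2 ⟨l, mem_univ l, mem_filter.2 ⟨hp, hpk, hUl, hVl⟩⟩
  -- each support rectangle is Kaibel–Weltge valid
  have hvalid : ∀ l, IsKWValid (Rl l) := by
    intro l p hp q hq hcard
    obtain ⟨-, hpk, hUp, -⟩ := mem_filter.1 hp
    obtain ⟨-, hqk, -, hVq⟩ := mem_filter.1 hq
    have h0 : (0 : ℝ) = ∑ l', U ⟨p.1, hpk⟩ l' * V l' q.2 := by
      have := hS ⟨p.1, hpk⟩ q.2
      rwa [if_pos hcard] at this
    have hle : U ⟨p.1, hpk⟩ l * V l q.2 ≤ ∑ l', U ⟨p.1, hpk⟩ l' * V l' q.2 :=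
      single_le_sum (f := fun l' => U ⟨p.1, hpk⟩ l' * V l' q.2) (fun l' _ => mul_nonneg (hU _ _) (hV _ _))
        (mem_univ l)
    have hpos : 0 < U ⟨p.1, hpk⟩ l * V l q.2 := mul_pos hUp hVq
    linarith
  have hRsub : ∀ l, Rl l ⊆ disjPairs (univ : Finset (Fin n)) := fun l p hp =>
    (mem_filter.1 (mem_filter.1 hp).1).1
  have hRcard : ∀ l, (Rl l).card ≤ 2 ^ n := fun l => by
    have := IsKWValid.card_le_two_pow (univ : Finset (Fin n)) (Rl l) (hvalid l) (hRsub l)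
    rwa [card_univ, Fintype.card_fin] at this
  -- count
  have hDcard : D.card = n.choose k * 2 ^ (n - k) := card_disjPairs_fst_card n k
  have hcount : n.choose k * 2 ^ (n - k) ≤ r * 2 ^ n := by
    rw [← hDcard]
    calc D.card ≤ (univ.biUnion Rl).card := card_le_card hcover
      _ ≤ ∑ l, (Rl l).card := card_biUnion_le
      _ ≤ ∑ _l : Fin r, 2 ^ n := sum_le_sum fun l _ => hRcard l
      _ = r * 2 ^ n := by rw [sum_const, card_univ, Fintype.card_fin, smul_eq_mul]
  have h2 : 2 ^ n = 2 ^ (n - k) * 2 ^ k := by rw [← pow_add, Nat.sub_add_cancel hkn]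
  rw [h2, ← mul_assoc] at hcount
  have hpos : 0 < 2 ^ (n - k) := Nat.two_pow_pos _
  have : n.choose k * 2 ^ (n - k) ≤ (r * 2 ^ k) * 2 ^ (n - k) := by linarith [hcount]
  exact Nat.le_of_mul_le_mul_right this hpos

/-- **Example 3.11 at formulation level**: the `k`-junta maximization problem over `{0,1}ⁿ` (`1 ≤ k ≤ n`) has no exact LP
formulation of size `R` with `(R+1)·2^k < C(n,k)` — "the LP formulation for `k`-juntas derived from the level-`k`
Sherali–Adams hierarchy [`O(n^k)` inequalities] is essentially optimal for small `k`" (`C(n,k)/2^k = Ω(n^k)` for constant `k`).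
[cite: BraunPokuttaZink2015, Ex. 3.11] [cite: KaibelWeltge2014, Thm. 1] -/
theorem junta_lpFormulation_lower (hk : 1 ≤ k) (hkn : k ≤ n) {R : ℕ} (hR : (R + 1) * 2 ^ k < n.choose k) :
    IsEmpty (LPFormulation (juntaProblem n k) R) :=
  LPFormulation.isEmpty_of_not_hasNonnegFactorization fun h => by
    have := choose_le_of_hasNonnegFactorization_junta hk hkn h
    omega

end Literature.Combinatorics.Optimization

end
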